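import Literature.Analysis.FluidPDE.SteadyLiouvilleCriteria
import Literature.Analysis.FluidPDE.NecasRuzickaSverakRiesz
import Literature.Analysis.FluidPDE.TsaiGradientEstimate
import Literature.Analysis.FluidPDE.LerayProfileRegularity
import Literature.Analysis.FluidPDE.WeaklyHarmonicInteriorBound
import HarnessLib

/-!
# Galdi's `L^{9/2}` Liouville criterion for steady D-solutions — proof

Discharge of the named fact `Literature.Analysis.FluidPDE.galdi_liouville_nineHalves`
(`SteadyLiouvilleCriteria.lean`): for `ν > 0`, a `C²` steady solution `(U, P)` of
`−νΔU + (U·∇)U + ∇P = 0`, `div U = 0` on `ℝ³` (`IsLerayProfile ν 0 U P`) with finite Dirichlet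
integral, `U → 0` at infinity and `U ∈ L^{9/2}(ℝ³)` is identically zero (G. P. Galdi, *An
Introduction to the Mathematical Theory of the Navier–Stokes Equations. Steady-State Problems*,
2nd ed. (2011), Theorem X.9.5, p. 729; restated in Seregin–Wang, St. Petersburg Math. J. 31
(2020), §1 and Remark 1.2 (i), and in Wang 2025, Thm 2.2 with the Caccioppoli inequality (2.11)).
Main result: `galdi_liouville_nineHalves_holds`.

## The printed argument and its formalisation

Galdi's proof (Thm X.9.5; in the form of Wang 2025, (2.11)): test the system with `φ_R u` for a
cut-off `φ_R` (`= 1` on `B_R`, supported in `B_{2R}`, `|∇φ_R| ≲ R⁻¹`, `|Δφ_R| ≲ R⁻²`) and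
integrate by parts,
`ν∫φ_R|∇u|² = (ν/2)∫Δφ_R|u|² + ½∫(u·∇φ_R)|u|² + ∫(p − c)(u·∇φ_R)`;
the pressure is, up to a constant, the Calderón–Zygmund pressure `RᵢRⱼ(uᵢuⱼ) ∈ L^{9/4}`, so by
Hölder with `u ∈ L^{9/2}` every term on the right is `o(1)` as `R → ∞`; hence `∇u ≡ 0` and
`u → 0` gives `u ≡ 0`. Every analytic input is already PROVED in the tree, for the profile class
`IsLerayProfile ν a U P` at `a = 0`:

* smoothness `U ∈ C^∞` of `C²` profiles (`IsLerayProfile.contDiff_velocity_infty`,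
  `LerayProfileRegularity`; needed by the energy identity, which is stated for smooth `U`);
* the Caccioppoli inequality on balls with explicit constants,
  `ν∫_{B_R}|DU|² ≤ νC₂/(2R²)∫_{B̄_{2R}}|U|² + C₁/(2R)∫_{B̄_{2R}}|U|³ + C₁/R ∫_{B̄_{2R}}|P − c||U|`
  (`IsLerayProfile.exists_gradient_estimate_consts`, `TsaiGradientEstimate`, at `a = 0`, `x₀ = 0`);
* the Calderón–Zygmund pressure `Q ∈ L^{9/4}` with `−ΔQ = ∂ᵢ∂ⱼ(UᵢUⱼ)` weakly
  (`nrs1996_rieszPressure_holds`, `NecasRuzickaSverakRiesz`, with `q = 9/4`);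
* the weak pressure–Poisson equation of a profile and Tsai's fixed-scale Liouville estimate for
  `P − Q` (`IsLerayProfile.integral_pressure_mul_laplacian_eq_neg_integral_hessian`,
  `IsLerayProfile.abs_fderiv_normed_convolution_sub_le`, `TsaiSelfSimilarPressureProofs`), the
  interior estimate for weakly harmonic functions
  (`exists_const_ae_abs_le_integral_of_weaklyHarmonic`, `WeaklyHarmonicInteriorBound`), Hölder on
  balls (`setIntegral_norm_closedBall_le_holder`, `NecasRuzickaSverakPressure`).

What is proved here:

* §1 `IsLerayProfile.exists_sub_ae_eq_const_nineHalves` — for a profile with `U` bounded,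
  `∫|U|^{9/2} < ∞` and `Q ∈ L^{9/4}` solving the pressure–Poisson equation weakly, `P − Q` is a.e.
  constant: Tsai's fixed-scale estimate applies with the ball bounds `∫_{B_ϱ}|U| ≲ ϱ^{13/5}`,
  `∫_{B_ϱ}|U|² ≲ ϱ^{11/5}` (Hölder with `U ∈ L^{15/2} ⊃ L^{9/2} ∩ L^∞`) and
  `∫_{B_ϱ}|Q| ≲ ϱ^{11/5}` (Hölder for `ϱ ≥ 1`; for `ϱ ≤ 1` the interior estimate for the weakly
  harmonic `P − Q` bounds `Q` a.e. near the origin), so every mollification of `P − Q` has zero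
  gradient, and the mollifications converge a.e.;
* §2 the `o(R)` lemma `tendsto_inv_mul_setLIntegral_closedBall` (tails of `∫|U|^{9/2}`, Hölder on
  `B̄_{2R} ∖ B̄_{n₀}`, `|B̄_{2R}|^{1/3} = O(R)`) with the two Hölder inequalities it is fed;
* §3 `galdi_liouville_nineHalves_holds`: the quadratic term is `O(R^{-1/3})`, the cubic and
  pressure terms are `o(1)`, so `∫_{B_ρ}|DU|² = 0` for every `ρ`, `DU ≡ 0`, `U` is constant and
  `U → 0` forces `U ≡ 0`. The finite-Dirichlet-integral hypothesis of the fact is not used.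

## References

* G. P. Galdi, *An Introduction to the Mathematical Theory of the Navier–Stokes Equations.
  Steady-State Problems*, 2nd ed., Springer (2011), Theorem X.9.5 (p. 729). [Galdi2011]
* G. Seregin, W. Wang, *Sufficient conditions on Liouville type theorems for the 3D steady
  Navier–Stokes equations*, St. Petersburg Math. J. 31 (2020) 387–393 (arXiv:1805.02227), §1,
  Remark 1.2 (i). [SereginWang2020]
* W. Wang, *Liouville theorems for the steady Navier–Stokes equations* (2025), Thm 2.2, (2.11).
  [Wang2025SteadyLiouville]
* J. Nečas, M. Růžička, V. Šverák, Acta Math. 176 (1996) 283–294, §2 p. 285, Lemma 3.1.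
  [NecasRuzickaSverak1996]
* T.-P. Tsai, Arch. Rational Mech. Anal. 143 (1998) 29–51, Lemma 2.1, Lemma 3.1. [Tsai1998]
-/
noncomputable section

open MeasureTheory Set Filter Metric Topology InnerProductSpace Function ContinuousLinearMap
open scoped ENNReal NNReal RealInnerProductSpace ContDiff Laplacian Convolution

namespace Literature.Analysis.FluidPDE

/-! ## §1. The Liouville step for the pressure: `P − Q` is constant when `U ∈ L^{9/2} ∩ L^∞` -/

section PressureConstancy

open TopologicalSpace

variable {ν a : ℝ} {U : EuclideanSpace ℝ (Fin 3) → EuclideanSpace ℝ (Fin 3)} {P : EuclideanSpace ℝ (Fin 3) → ℝ}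

/-- A bounded field with `∫ |U|^{9/2} < ∞` has `∫ |U|^{15/2} < ∞`. [folklore] -/
theorem lintegral_rpow_fifteenHalves_ne_top {M : ℝ}
    (hM : ∀ x, ‖U x‖ ≤ M) (hIU : ∫⁻ y, ‖U y‖ₑ ^ (9 / 2 : ℝ) ≠ ⊤) :
    ∫⁻ y, ‖U y‖ₑ ^ (15 / 2 : ℝ) ≠ ⊤ := by
  have hM0 : 0 ≤ M := (norm_nonneg _).trans (hM 0)
  have hpt : ∀ y, ‖U y‖ₑ ^ (15 / 2 : ℝ) ≤ ENNReal.ofReal M ^ (3 : ℝ) * ‖U y‖ₑ ^ (9 / 2 : ℝ) := by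
    intro y
    have hsplit : ‖U y‖ₑ ^ (15 / 2 : ℝ) = ‖U y‖ₑ ^ (3 : ℝ) * ‖U y‖ₑ ^ (9 / 2 : ℝ) := by
      rw [← ENNReal.rpow_add_of_nonneg _ _ (by norm_num) (by norm_num)]
      norm_num
    rw [hsplit]
    refine mul_le_mul' (ENNReal.rpow_le_rpow ?_ (by norm_num)) le_rfl
    rw [← ofReal_norm]
    exact ENNReal.ofReal_le_ofReal (hM y)
  refine ne_top_of_le_ne_top ?_ (lintegral_mono hpt)
  rw [lintegral_const_mul' _ _ (ENNReal.rpow_ne_top_of_nonneg (by norm_num) ENNReal.ofReal_ne_top)]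
  exact ENNReal.mul_ne_top (ENNReal.rpow_ne_top_of_nonneg (by norm_num) ENNReal.ofReal_ne_top) hIU

/-- **The Liouville step for `U ∈ L^{9/2} ∩ L^∞`: mollifications of `P − Q` have zero gradient**
(Galdi 2011, proof of Thm X.9.5, identification of the pressure with the Riesz-transform pressure;
the argument is NRŠ 1996, proof of Lemma 3.1 / Tsai 1998, Lemma 2.1, last assertion). Let `(U, P)`
be a Leray profile with `U` bounded and `∫ |U|^{9/2} < ∞`, and let `Q ∈ L^{9/4}` solve
`−ΔQ = ∂ᵢ∂ⱼ(UᵢUⱼ)` in `𝒟'(ℝ³)`. Then `ψ ⋆ (P − Q)` has vanishing gradient for every bump `ψ`: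
the fixed-scale estimate `IsLerayProfile.abs_fderiv_normed_convolution_sub_le` applies with the
ball bounds `∫_{B_ϱ}|U| ≲ ϱ^{13/5}`, `∫_{B_ϱ}|U|² ≲ ϱ^{11/5}` (Hölder with `U ∈ L^{15/2}`) and
`∫_{B_ϱ}|Q| ≲ ϱ^{11/5}` (Hölder with `Q ∈ L^{9/4}` for `ϱ ≥ 1`; for `ϱ ≤ 1` the interior estimate
for the weakly harmonic `P − Q` bounds `Q` a.e. near the origin), and `R → ∞`.
[cite: Galdi2011, Thm X.9.5 (proof); NecasRuzickaSverak1996, Lemma 3.1 proof (pp. 287–288)] -/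
theorem IsLerayProfile.fderiv_normed_convolution_sub_eq_zero_nineHalves (hprof : IsLerayProfile ν a U P)
    {M : ℝ} (hM : ∀ x, ‖U x‖ ≤ M) (hIU : ∫⁻ y, ‖U y‖ₑ ^ (9 / 2 : ℝ) ≠ ⊤)
    {Q : EuclideanSpace ℝ (Fin 3) → ℝ} (hQm : AEStronglyMeasurable Q volume)
    (hIQ : ∫⁻ y, ‖Q y‖ₑ ^ (9 / 4 : ℝ) ≠ ⊤)
    (hQ : ∀ φ : EuclideanSpace ℝ (Fin 3) → ℝ, ContDiff ℝ (⊤ : ℕ∞) φ → HasCompactSupport φ →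
      ∫ y, Q y * (Δ φ) y = -∫ y, fderiv ℝ (fderiv ℝ φ) y (U y) (U y))
    (ψ : ContDiffBump (0 : EuclideanSpace ℝ (Fin 3))) (y e : EuclideanSpace ℝ (Fin 3)) :
    fderiv ℝ (ψ.normed volume ⋆[lsmul ℝ ℝ, volume] fun x => P x - Q x) y e = 0 := by
  -- exponents and basic regularity
  have hpq₁ : (15 / 2 : ℝ).HolderConjugate (15 / 13) := ⟨by norm_num, by norm_num, by norm_num⟩
  have hpq₂ : (15 / 4 : ℝ).HolderConjugate (15 / 11) := ⟨by norm_num, by norm_num, by norm_num⟩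
  have hpq₃ : (9 / 4 : ℝ).HolderConjugate (9 / 5) := ⟨by norm_num, by norm_num, by norm_num⟩
  have hU1 : ContDiff ℝ 1 U := hprof.contDiff_velocity.of_le one_le_two
  have hP1 := hprof.contDiff_pressure
  have hUm : AEStronglyMeasurable U volume := hU1.continuous.aestronglyMeasurable
  have hU2m : AEStronglyMeasurable (fun x => ‖U x‖ ^ 2) volume :=
    (hU1.continuous.norm.pow 2).aestronglyMeasurable
  have hIU15 : ∫⁻ y, ‖U y‖ₑ ^ (15 / 2 : ℝ) ≠ ⊤ := lintegral_rpow_fifteenHalves_ne_top hM hIU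
  have hIU2 : ∫⁻ x, ‖(‖U x‖ ^ 2)‖ₑ ^ (15 / 4 : ℝ) ≠ ⊤ := by
    have h : ∀ x, ‖(‖U x‖ ^ 2)‖ₑ ^ (15 / 4 : ℝ) = ‖U x‖ₑ ^ (15 / 2 : ℝ) := fun x => by
      rw [Real.enorm_eq_ofReal (sq_nonneg _), ENNReal.ofReal_pow (norm_nonneg _), ofReal_norm,
        ← ENNReal.rpow_natCast, ← ENNReal.rpow_mul]
      norm_num
    simp_rw [h]
    exact hIU15
  -- the ball bounds for `U` and `|U|²` (Hölder with `U ∈ L^{15/2}`)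
  have hballU : ∀ ϱ : ℝ, 0 < ϱ → IntegrableOn U (closedBall (0 : EuclideanSpace ℝ (Fin 3)) ϱ) ∧
      ∫ x in closedBall (0 : EuclideanSpace ℝ (Fin 3)) ϱ, ‖U x‖ ≤
        ((∫⁻ x, ‖U x‖ₑ ^ (15 / 2 : ℝ)) ^ (1 / (15 / 2 : ℝ)) *
          volume (ball (0 : EuclideanSpace ℝ (Fin 3)) 1) ^ (1 / (15 / 13 : ℝ))).toReal * ϱ ^ (13 / 5 : ℝ) := fun ϱ hϱ => by
    have h := setIntegral_norm_closedBall_le_holder hUm hpq₁ hIU15 hϱ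
    exact ⟨h.1, h.2.trans_eq (by norm_num)⟩
  have hballU2 : ∀ ϱ : ℝ, 0 < ϱ → IntegrableOn (fun x => ‖U x‖ ^ 2) (closedBall (0 : EuclideanSpace ℝ (Fin 3)) ϱ) ∧
      ∫ x in closedBall (0 : EuclideanSpace ℝ (Fin 3)) ϱ, ‖(‖U x‖ ^ 2)‖ ≤
        ((∫⁻ x, ‖(‖U x‖ ^ 2)‖ₑ ^ (15 / 4 : ℝ)) ^ (1 / (15 / 4 : ℝ)) *
          volume (ball (0 : EuclideanSpace ℝ (Fin 3)) 1) ^ (1 / (15 / 11 : ℝ))).toReal * ϱ ^ (11 / 5 : ℝ) := fun ϱ hϱ => by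
    have h := setIntegral_norm_closedBall_le_holder hU2m hpq₂ hIU2 hϱ
    exact ⟨h.1, h.2.trans_eq (by norm_num)⟩
  -- `P - Q` is weakly harmonic
  have hQl : LocallyIntegrable Q volume := locallyIntegrable_of_holder hQm hpq₃ hIQ
  have hgl : LocallyIntegrable (fun x => P x - Q x) volume :=
    hP1.continuous.locallyIntegrable.sub hQl
  have hharm : ∀ φ : EuclideanSpace ℝ (Fin 3) → ℝ, ContDiff ℝ (⊤ : ℕ∞) φ → HasCompactSupport φ →
      ∫ x, (P x - Q x) * (Δ φ) x = 0 := by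
    intro φ hφ hφc
    have hΔc : Continuous (Δ φ) := FluidPDE.continuous_laplacian (contDiff_infty.1 hφ 2)
    have hΔs : HasCompactSupport (Δ φ) :=
      hφc.mono' fun x hx => by
        contrapose! hx
        simp [FluidPDE.laplacian_eq_zero_of_notMem_tsupport hx]
    have i1 : Integrable fun x => P x * (Δ φ) x :=
      (hP1.continuous.mul hΔc).integrable_of_hasCompactSupport hΔs.mul_left
    have i2 : Integrable fun x => Q x * (Δ φ) x := by
      simpa only [smul_eq_mul] using hQl.integrable_smul_right_of_hasCompactSupport hΔc hΔs
    simp_rw [sub_mul]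
    rw [integral_sub i1 i2, hprof.integral_pressure_mul_laplacian_eq_neg_integral_hessian hφ hφc,
      hQ φ hφ hφc, sub_self]
  -- the ball bound for `Q`: Hölder for `ϱ ≥ 1`, the interior estimate for `ϱ ≤ 1`
  set AQ₁ : ℝ := ((∫⁻ x, ‖Q x‖ₑ ^ (9 / 4 : ℝ)) ^ (1 / (9 / 4 : ℝ)) *
    volume (ball (0 : EuclideanSpace ℝ (Fin 3)) 1) ^ (1 / (9 / 5 : ℝ))).toReal with hAQ₁_def
  have hAQ₁0 : 0 ≤ AQ₁ := ENNReal.toReal_nonneg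
  have hballQ₁ : ∀ ϱ : ℝ, 0 < ϱ → IntegrableOn Q (closedBall (0 : EuclideanSpace ℝ (Fin 3)) ϱ) ∧
      ∫ x in closedBall (0 : EuclideanSpace ℝ (Fin 3)) ϱ, ‖Q x‖ ≤ AQ₁ * ϱ ^ (5 / 3 : ℝ) :=
      fun ϱ hϱ => by
    have h := setIntegral_norm_closedBall_le_holder hQm hpq₃ hIQ hϱ
    exact ⟨h.1, h.2.trans_eq (by rw [hAQ₁_def]; norm_num)⟩
  obtain ⟨Cw, hCw0, hCw⟩ := exists_const_ae_abs_le_integral_of_weaklyHarmonic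
  have hint4 : IntegrableOn (fun x => P x - Q x) (ball (0 : EuclideanSpace ℝ (Fin 3)) 4) volume :=
    (hgl.integrableOn_isCompact (isCompact_closedBall 0 4)).mono_set ball_subset_closedBall
  set K : ℝ := Cw * ((4 : ℝ) ^ 3)⁻¹ * ∫ x in ball (0 : EuclideanSpace ℝ (Fin 3)) 4, |P x - Q x| with hK_def
  have hK0 : 0 ≤ K := by
    rw [hK_def]
    exact mul_nonneg (by positivity) (integral_nonneg fun x => abs_nonneg _)
  have hae : ∀ᵐ x ∂(volume.restrict (ball (0 : EuclideanSpace ℝ (Fin 3)) 2)), |P x - Q x| ≤ K := by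
    have h := hCw (fun x => P x - Q x) 0 4 (by norm_num) hint4
      (fun φ hφ hφc _ => hharm φ hφ hφc)
    rw [show (4 : ℝ) / 2 = 2 by norm_num] at h
    exact h
  obtain ⟨MP, hMP⟩ := (isCompact_closedBall (0 : EuclideanSpace ℝ (Fin 3)) 2).exists_bound_of_continuousOn
    hP1.continuous.continuousOn
  set MP' : ℝ := max MP 0 with hMP'_def
  have hMP'0 : 0 ≤ MP' := le_max_right _ _
  set v : ℝ := (volume : Measure (EuclideanSpace ℝ (Fin 3))).real (ball (0 : EuclideanSpace ℝ (Fin 3)) 1)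
    with hv_def
  have hv0 : 0 ≤ v := measureReal_nonneg
  set AQ : ℝ := AQ₁ + (MP' + K) * v with hAQ_def
  have hAQ0 : 0 ≤ AQ := by positivity
  have hballQ : ∀ ϱ : ℝ, 0 < ϱ → IntegrableOn Q (closedBall (0 : EuclideanSpace ℝ (Fin 3)) ϱ) ∧
      ∫ x in closedBall (0 : EuclideanSpace ℝ (Fin 3)) ϱ, ‖Q x‖ ≤ AQ * ϱ ^ (11 / 5 : ℝ) := by
    intro ϱ hϱ
    obtain ⟨hQint, hQϱ⟩ := hballQ₁ ϱ hϱ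
    refine ⟨hQint, ?_⟩
    rcases le_total ϱ 1 with hϱ1 | hϱ1
    · -- small balls: `|Q| ≤ |P| + K ≤ MP' + K` a.e. on `B̄_ϱ ⊆ B(0, 2)`
      have hsub : closedBall (0 : EuclideanSpace ℝ (Fin 3)) ϱ ⊆ ball (0 : EuclideanSpace ℝ (Fin 3)) 2 := closedBall_subset_ball (by linarith)
      have hae' : ∀ᵐ x ∂(volume.restrict (closedBall (0 : EuclideanSpace ℝ (Fin 3)) ϱ)), ‖Q x‖ ≤ MP' + K := by
        filter_upwards [ae_restrict_of_ae_restrict_of_subset hsub hae,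
          ae_restrict_mem measurableSet_closedBall] with x hx hxmem
        have hPx : |P x| ≤ MP' :=
          (Real.norm_eq_abs _ ▸ hMP x (closedBall_subset_closedBall (by linarith) hxmem)).trans
            (le_max_left _ _)
        rw [Real.norm_eq_abs]
        calc |Q x| = |P x - (P x - Q x)| := by ring_nf
          _ ≤ |P x| + |P x - Q x| := abs_sub _ _
          _ ≤ MP' + K := add_le_add hPx hx
      have hvolϱ :
          (volume : Measure (EuclideanSpace ℝ (Fin 3))).real (closedBall (0 : EuclideanSpace ℝ (Fin 3)) ϱ) = ϱ ^ 3 * v := by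
        rw [Measure.addHaar_real_closedBall _ _ hϱ.le, finrank_euclideanSpace_fin]
      have hfin : volume (closedBall (0 : EuclideanSpace ℝ (Fin 3)) ϱ) < ⊤ := measure_closedBall_lt_top
      have hconst : IntegrableOn (fun _ => MP' + K) (closedBall (0 : EuclideanSpace ℝ (Fin 3)) ϱ) volume :=
        integrableOn_const hfin.ne
      have h1 : ∫ x in closedBall (0 : EuclideanSpace ℝ (Fin 3)) ϱ, ‖Q x‖ ≤ ∫ _ in closedBall (0 : EuclideanSpace ℝ (Fin 3)) ϱ, (MP' + K) :=
        integral_mono_ae hQint.norm hconst hae'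
      rw [setIntegral_const, smul_eq_mul, hvolϱ] at h1
      have hpow : ϱ ^ 3 ≤ ϱ ^ (11 / 5 : ℝ) := by
        rw [show ϱ ^ 3 = ϱ ^ (3 : ℝ) by rw [← Real.rpow_natCast]; norm_num]
        exact Real.rpow_le_rpow_of_exponent_ge hϱ hϱ1 (by norm_num)
      calc ∫ x in closedBall (0 : EuclideanSpace ℝ (Fin 3)) ϱ, ‖Q x‖ ≤ ϱ ^ 3 * v * (MP' + K) := h1
        _ ≤ ϱ ^ (11 / 5 : ℝ) * v * (MP' + K) := by gcongr
        _ = (MP' + K) * v * ϱ ^ (11 / 5 : ℝ) := by ring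
        _ ≤ AQ * ϱ ^ (11 / 5 : ℝ) := by
            rw [hAQ_def]
            exact mul_le_mul_of_nonneg_right (le_add_of_nonneg_left hAQ₁0) (by positivity)
    · -- large balls: Hölder
      have hpow : ϱ ^ (5 / 3 : ℝ) ≤ ϱ ^ (11 / 5 : ℝ) :=
        Real.rpow_le_rpow_of_exponent_le hϱ1 (by norm_num)
      calc ∫ x in closedBall (0 : EuclideanSpace ℝ (Fin 3)) ϱ, ‖Q x‖ ≤ AQ₁ * ϱ ^ (5 / 3 : ℝ) := hQϱ
        _ ≤ AQ₁ * ϱ ^ (11 / 5 : ℝ) := mul_le_mul_of_nonneg_left hpow hAQ₁0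
        _ ≤ AQ * ϱ ^ (11 / 5 : ℝ) := by
            rw [hAQ_def]
            exact mul_le_mul_of_nonneg_right (le_add_of_nonneg_right (by positivity))
              (by positivity)
  -- constants and the fixed-scale estimate
  obtain ⟨⟨C₁, hC₁⟩, ⟨C₂, hC₂⟩⟩ := exists_bound_baseBump_derivs (E := (EuclideanSpace ℝ (Fin 3)))
  have hC₁0 : 0 ≤ C₁ := (norm_nonneg _).trans (hC₁ 0)
  have hC₂0 : 0 ≤ C₂ := (abs_nonneg _).trans (hC₂ 0)
  obtain ⟨K', hK'⟩ : ∃ K' : ℝ, ∀ R : ℝ, 1 ≤ R →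
      |fderiv ℝ (ψ.normed volume ⋆[lsmul ℝ ℝ, volume] fun x => P x - Q x) y e| ≤
        K' * R ^ (-(2 / 5) : ℝ) :=
    ⟨_, fun R hR => hprof.abs_fderiv_normed_convolution_sub_le hQl hharm ENNReal.toReal_nonneg
      ENNReal.toReal_nonneg hAQ0 hballU hballU2 hballQ hC₁ hC₂ hC₁0 hC₂0 ψ y e hR⟩
  -- let `R → ∞`
  have hlim : Tendsto (fun R : ℝ => K' * R ^ (-(2 / 5) : ℝ)) atTop (𝓝 0) := by
    simpa using (tendsto_rpow_neg_atTop (by norm_num : (0 : ℝ) < 2 / 5)).const_mul K'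
  have hle : |fderiv ℝ (ψ.normed volume ⋆[lsmul ℝ ℝ, volume] fun x => P x - Q x) y e| ≤ 0 :=
    ge_of_tendsto hlim (eventually_atTop.2 ⟨1, fun R hR => hK' R hR⟩)
  exact abs_nonpos_iff.1 hle

/-- **`P − Q` is a.e. constant** for a Leray profile with `U` bounded, `∫ |U|^{9/2} < ∞` and
`Q ∈ L^{9/4}` solving the pressure Poisson equation weakly (Galdi 2011, proof of Thm X.9.5: the
pressure of a D-solution in `L^{9/2}` is, up to a constant, the Calderón–Zygmund pressure
`RᵢRⱼ(UᵢUⱼ) ∈ L^{9/4}`; proof as NRŠ 1996, Lemma 3.1): every mollification of `P − Q` has zero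
gradient, hence is constant, and the mollifications converge to `P − Q` a.e.
[cite: Galdi2011, Thm X.9.5 (proof); NecasRuzickaSverak1996, Lemma 3.1 (p. 287)] -/
theorem IsLerayProfile.exists_sub_ae_eq_const_nineHalves (hprof : IsLerayProfile ν a U P)
    {M : ℝ} (hM : ∀ x, ‖U x‖ ≤ M) (hIU : ∫⁻ y, ‖U y‖ₑ ^ (9 / 2 : ℝ) ≠ ⊤)
    {Q : EuclideanSpace ℝ (Fin 3) → ℝ} (hQm : AEStronglyMeasurable Q volume)
    (hIQ : ∫⁻ y, ‖Q y‖ₑ ^ (9 / 4 : ℝ) ≠ ⊤)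
    (hQ : ∀ φ : EuclideanSpace ℝ (Fin 3) → ℝ, ContDiff ℝ (⊤ : ℕ∞) φ → HasCompactSupport φ →
      ∫ y, Q y * (Δ φ) y = -∫ y, fderiv ℝ (fderiv ℝ φ) y (U y) (U y)) :
    ∃ c : ℝ, ∀ᵐ x ∂(volume : Measure (EuclideanSpace ℝ (Fin 3))), P x - Q x = c := by
  have hpq₃ : (9 / 4 : ℝ).HolderConjugate (9 / 5) := ⟨by norm_num, by norm_num, by norm_num⟩
  have hQl : LocallyIntegrable Q volume := locallyIntegrable_of_holder hQm hpq₃ hIQ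
  set g : EuclideanSpace ℝ (Fin 3) → ℝ := fun x => P x - Q x with hg_def
  have hgl : LocallyIntegrable g volume :=
    hprof.contDiff_pressure.continuous.locallyIntegrable.sub hQl
  obtain ⟨φ, hφ0, hφ2⟩ := FunctionSpaces.exists_contDiffBump_seq (E := (EuclideanSpace ℝ (Fin 3)))
  -- each mollification is constant
  have hconst : ∀ k x, ((φ k).normed volume ⋆[lsmul ℝ ℝ, volume] g) x =
      ((φ k).normed volume ⋆[lsmul ℝ ℝ, volume] g) 0 := by
    intro k x
    have hdiff : Differentiable ℝ ((φ k).normed volume ⋆[lsmul ℝ ℝ, volume] g) :=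
      ((φ k).hasCompactSupport_normed.contDiff_convolution_left _
        ((φ k).contDiff_normed (n := 1)) hgl).differentiable one_ne_zero
    have hzero : ∀ y, fderiv ℝ ((φ k).normed volume ⋆[lsmul ℝ ℝ, volume] g) y = 0 := fun y => by
      ext e
      exact hprof.fderiv_normed_convolution_sub_eq_zero_nineHalves hM hIU hQm hIQ hQ (φ k) y e
    exact is_const_of_fderiv_eq_zero hdiff hzero x 0
  have hlim := FunctionSpaces.ae_tendsto_normed_convolution hφ0 hφ2 hgl
  refine ⟨limUnder atTop fun k => ((φ k).normed volume ⋆[lsmul ℝ ℝ, volume] g) 0, ?_⟩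
  filter_upwards [hlim] with x hx
  simp_rw [hconst _ x] at hx
  exact hx.limUnder_eq.symm

end PressureConstancy

/-! ## §2. Tails, Hölder on sets of finite measure, and the `o(R)` lemma -/

section Tails

/-- Tails of a finite integral over the complements of large balls are small:
`∫_{|x| > n} G → 0` as `n → ∞` when `∫ G < ∞` (dominated convergence). [folklore] -/
theorem tendsto_setLIntegral_compl_closedBall_nat {G : EuclideanSpace ℝ (Fin 3) → ℝ≥0∞} (hG : AEMeasurable G volume)
    (hfin : ∫⁻ x, G x ≠ ⊤) :
    Tendsto (fun n : ℕ => ∫⁻ x in (closedBall (0 : EuclideanSpace ℝ (Fin 3)) n)ᶜ, G x) atTop (𝓝 0) := by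
  have h : ∀ n : ℕ, ∫⁻ x in (closedBall (0 : EuclideanSpace ℝ (Fin 3)) n)ᶜ, G x =
      ∫⁻ x, ((closedBall (0 : EuclideanSpace ℝ (Fin 3)) n)ᶜ).indicator G x := fun n =>
    (lintegral_indicator measurableSet_closedBall.compl _).symm
  simp_rw [h]
  have key := tendsto_lintegral_of_dominated_convergence' (μ := (volume : Measure (EuclideanSpace ℝ (Fin 3))))
    (F := fun n : ℕ => ((closedBall (0 : EuclideanSpace ℝ (Fin 3)) n)ᶜ).indicator G) (f := fun _ => 0) G
    (fun n => hG.indicator measurableSet_closedBall.compl)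
    (fun n => ae_of_all _ fun x => indicator_le_self _ _ x) hfin
    (ae_of_all _ fun x => ?_)
  · simpa using key
  · refine tendsto_const_nhds.congr' ?_
    filter_upwards [eventually_ge_atTop ⌈‖x‖⌉₊] with n hn
    rw [indicator_of_notMem]
    rw [notMem_compl_iff, mem_closedBall_zero_iff]
    exact (Nat.le_ceil _).trans (by exact_mod_cast hn)

/-- Hölder on a set: `∫_S |U|³ ≤ (∫_S |U|^{9/2})^{2/3} |S|^{1/3}`. [folklore] -/
theorem setLIntegral_rpow_three_le {U : EuclideanSpace ℝ (Fin 3) → EuclideanSpace ℝ (Fin 3)} (hU : AEStronglyMeasurable U volume)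
    (S : Set (EuclideanSpace ℝ (Fin 3))) :
    ∫⁻ x in S, ‖U x‖ₑ ^ (3 : ℝ) ≤
      (∫⁻ x in S, ‖U x‖ₑ ^ (9 / 2 : ℝ)) ^ (2 / 3 : ℝ) * volume S ^ (1 / 3 : ℝ) := by
  set μ : Measure (EuclideanSpace ℝ (Fin 3)) := volume.restrict S with hμ
  have hpq : (3 / 2 : ℝ).HolderConjugate 3 := ⟨by norm_num, by norm_num, by norm_num⟩
  have hf : AEMeasurable (fun x => ‖U x‖ₑ ^ (3 : ℝ)) μ := hU.restrict.enorm.pow_const _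
  have hg : AEMeasurable (fun _ : EuclideanSpace ℝ (Fin 3) => (1 : ℝ≥0∞)) μ := aemeasurable_const
  have h := ENNReal.lintegral_mul_le_Lp_mul_Lq μ hpq hf hg
  have h1 :
      ∫⁻ x, ((fun x : EuclideanSpace ℝ (Fin 3) => ‖U x‖ₑ ^ (3 : ℝ)) *
        fun _ : EuclideanSpace ℝ (Fin 3) => (1 : ℝ≥0∞)) x ∂μ =
      ∫⁻ x, ‖U x‖ₑ ^ (3 : ℝ) ∂μ := lintegral_congr fun x => by simp
  have h2 : ∫⁻ x, (fun x => ‖U x‖ₑ ^ (3 : ℝ)) x ^ (3 / 2 : ℝ) ∂μ =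
      ∫⁻ x, ‖U x‖ₑ ^ (9 / 2 : ℝ) ∂μ := lintegral_congr fun x => by
    simp only
    rw [← ENNReal.rpow_mul]
    norm_num
  have h3 : (∫⁻ x, (fun _ : EuclideanSpace ℝ (Fin 3) => (1 : ℝ≥0∞)) x ^ (3 : ℝ) ∂μ) = volume S := by simp [hμ]
  rw [h1, h2, h3, show (1 : ℝ) / (3 / 2) = 2 / 3 by norm_num] at h
  exact h

/-- Hölder on a set, twice: `∫_S |Q||U| ≤ (∫_S |Q|^{9/4})^{4/9} (∫_S |U|^{9/2})^{2/9} |S|^{1/3}`.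
[folklore] -/
theorem setLIntegral_enorm_mul_enorm_le {Q : EuclideanSpace ℝ (Fin 3) → ℝ} {U : EuclideanSpace ℝ (Fin 3) → EuclideanSpace ℝ (Fin 3)}
    (hQ : AEStronglyMeasurable Q volume) (hU : AEStronglyMeasurable U volume) (S : Set (EuclideanSpace ℝ (Fin 3))) :
    ∫⁻ x in S, ‖Q x‖ₑ * ‖U x‖ₑ ≤
      (∫⁻ x in S, ‖Q x‖ₑ ^ (9 / 4 : ℝ)) ^ (4 / 9 : ℝ) *
        ((∫⁻ x in S, ‖U x‖ₑ ^ (9 / 2 : ℝ)) ^ (2 / 9 : ℝ) * volume S ^ (1 / 3 : ℝ)) := by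
  set μ : Measure (EuclideanSpace ℝ (Fin 3)) := volume.restrict S with hμ
  have hpq₁ : (9 / 4 : ℝ).HolderConjugate (9 / 5) := ⟨by norm_num, by norm_num, by norm_num⟩
  have hpq₂ : (5 / 2 : ℝ).HolderConjugate (5 / 3) := ⟨by norm_num, by norm_num, by norm_num⟩
  have hf : AEMeasurable (fun x => ‖Q x‖ₑ) μ := hQ.restrict.enorm
  have hg : AEMeasurable (fun x => ‖U x‖ₑ) μ := hU.restrict.enorm
  -- first Hölder: `∫ |Q||U| ≤ ‖Q‖_{9/4} ‖U‖_{9/5}`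
  have h := ENNReal.lintegral_mul_le_Lp_mul_Lq μ hpq₁ hf hg
  have h1 : ∫⁻ x, ((fun x => ‖Q x‖ₑ) * fun x => ‖U x‖ₑ) x ∂μ = ∫⁻ x, ‖Q x‖ₑ * ‖U x‖ₑ ∂μ :=
    lintegral_congr fun x => by simp
  rw [h1] at h
  -- second Hölder: `‖U‖_{9/5} ≤ ‖U‖_{9/2} |S|^{1/3}` on `S`
  have hg' : AEMeasurable (fun x => ‖U x‖ₑ ^ (9 / 5 : ℝ)) μ := hg.pow_const _
  have hone : AEMeasurable (fun _ : EuclideanSpace ℝ (Fin 3) => (1 : ℝ≥0∞)) μ := aemeasurable_const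
  have h' := ENNReal.lintegral_mul_le_Lp_mul_Lq μ hpq₂ hg' hone
  have h2 :
      ∫⁻ x, ((fun x : EuclideanSpace ℝ (Fin 3) => ‖U x‖ₑ ^ (9 / 5 : ℝ)) *
        fun _ : EuclideanSpace ℝ (Fin 3) => (1 : ℝ≥0∞)) x ∂μ =
      ∫⁻ x, ‖U x‖ₑ ^ (9 / 5 : ℝ) ∂μ := lintegral_congr fun x => by simp
  have h3 : ∫⁻ x, (fun x => ‖U x‖ₑ ^ (9 / 5 : ℝ)) x ^ (5 / 2 : ℝ) ∂μ =
      ∫⁻ x, ‖U x‖ₑ ^ (9 / 2 : ℝ) ∂μ := lintegral_congr fun x => by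
    simp only
    rw [← ENNReal.rpow_mul]
    norm_num
  have h4 : (∫⁻ x, (fun _ : EuclideanSpace ℝ (Fin 3) => (1 : ℝ≥0∞)) x ^ (5 / 3 : ℝ) ∂μ) = volume S := by simp [hμ]
  rw [h2, h3, h4] at h'
  -- raise to the power `5/9`
  have h'' : (∫⁻ x, ‖U x‖ₑ ^ (9 / 5 : ℝ) ∂μ) ^ (1 / (9 / 5 : ℝ)) ≤
      (∫⁻ x, ‖U x‖ₑ ^ (9 / 2 : ℝ) ∂μ) ^ (2 / 9 : ℝ) * volume S ^ (1 / 3 : ℝ) := by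
    have e : (1 : ℝ) / (9 / 5) = 5 / 9 := by norm_num
    rw [e]
    calc (∫⁻ x, ‖U x‖ₑ ^ (9 / 5 : ℝ) ∂μ) ^ (5 / 9 : ℝ)
        ≤ ((∫⁻ x, ‖U x‖ₑ ^ (9 / 2 : ℝ) ∂μ) ^ (1 / (5 / 2 : ℝ)) *
            volume S ^ (1 / (5 / 3 : ℝ))) ^ (5 / 9 : ℝ) := ENNReal.rpow_le_rpow h' (by norm_num)
      _ = (∫⁻ x, ‖U x‖ₑ ^ (9 / 2 : ℝ) ∂μ) ^ (2 / 9 : ℝ) * volume S ^ (1 / 3 : ℝ) := by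
          rw [ENNReal.mul_rpow_of_nonneg _ _ (by norm_num), ← ENNReal.rpow_mul,
            ← ENNReal.rpow_mul]
          norm_num
  calc ∫⁻ x, ‖Q x‖ₑ * ‖U x‖ₑ ∂μ
      ≤ (∫⁻ x, ‖Q x‖ₑ ^ (9 / 4 : ℝ) ∂μ) ^ (1 / (9 / 4 : ℝ)) *
          (∫⁻ x, ‖U x‖ₑ ^ (9 / 5 : ℝ) ∂μ) ^ (1 / (9 / 5 : ℝ)) := h
    _ ≤ (∫⁻ x, ‖Q x‖ₑ ^ (9 / 4 : ℝ) ∂μ) ^ (4 / 9 : ℝ) *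
          ((∫⁻ x, ‖U x‖ₑ ^ (9 / 2 : ℝ) ∂μ) ^ (2 / 9 : ℝ) * volume S ^ (1 / 3 : ℝ)) := by
        rw [show (1 : ℝ) / (9 / 4) = 4 / 9 by norm_num]
        exact mul_le_mul' le_rfl h''

/-- **The `o(R)` lemma.** Let `F ≥ 0` have finite integrals on balls and satisfy
`∫_S F ≤ K (∫_S G)^θ |S|^{1/3}` for all measurable `S`, with `∫ G < ∞`, `K < ∞`, `θ > 0`. Then
`R⁻¹ ∫_{B̄(0,2R)} F → 0` as `R → ∞`: split `B̄(0, 2R)` at a radius `n₀` beyond which the tail of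
`∫ G` is small, and use `|B̄(0,2R)|^{1/3} = O(R)`. (This is how `u ∈ L^{9/2}` makes the cubic and the
pressure terms of the localized energy inequality vanish in Galdi's proof.) [folklore] -/
theorem tendsto_inv_mul_setLIntegral_closedBall {F G : EuclideanSpace ℝ (Fin 3) → ℝ≥0∞}
    (hFloc : ∀ r : ℝ, ∫⁻ x in closedBall (0 : EuclideanSpace ℝ (Fin 3)) r, F x ≠ ⊤)
    (hG : AEMeasurable G volume) (hGfin : ∫⁻ x, G x ≠ ⊤) {K : ℝ≥0∞} (hK : K ≠ ⊤)
    {θ : ℝ} (hθ : 0 < θ)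
    (hFG : ∀ S : Set (EuclideanSpace ℝ (Fin 3)), MeasurableSet S →
      ∫⁻ x in S, F x ≤ K * (∫⁻ x in S, G x) ^ θ * volume S ^ (1 / 3 : ℝ)) :
    Tendsto (fun R : ℝ => R⁻¹ * (∫⁻ x in closedBall (0 : EuclideanSpace ℝ (Fin 3)) (2 * R), F x).toReal)
      atTop (𝓝 0) := by
  -- the unit-ball volume
  set v : ℝ≥0∞ := volume (ball (0 : EuclideanSpace ℝ (Fin 3)) 1) with hv
  have hvtop : v ≠ ⊤ := measure_ball_lt_top.ne
  have hv3top : v ^ (1 / 3 : ℝ) ≠ ⊤ := ENNReal.rpow_ne_top_of_nonneg (by norm_num) hvtop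
  set cv : ℝ := (v ^ (1 / 3 : ℝ)).toReal with hcv
  have hcv0 : 0 ≤ cv := ENNReal.toReal_nonneg
  -- the tails of `∫ G` and the quantity `A n = (K tail(n)^θ).toReal → 0`
  set tail : ℕ → ℝ≥0∞ := fun n => ∫⁻ x in (closedBall (0 : EuclideanSpace ℝ (Fin 3)) n)ᶜ, G x with htail
  have htail0 : Tendsto tail atTop (𝓝 0) := tendsto_setLIntegral_compl_closedBall_nat hG hGfin
  have htailtop : ∀ n, tail n ≠ ⊤ := fun n =>
    ne_top_of_le_ne_top hGfin (setLIntegral_le_lintegral _ _)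
  have hA0 : Tendsto (fun n => (K * tail n ^ θ).toReal) atTop (𝓝 0) := by
    have h1 : Tendsto (fun n => tail n ^ θ) atTop (𝓝 0) := by
      have hc := (ENNReal.continuous_rpow_const (y := θ)).tendsto (0 : ℝ≥0∞)
      rw [ENNReal.zero_rpow_of_pos hθ] at hc
      exact hc.comp htail0
    have h2 : Tendsto (fun n => K * tail n ^ θ) atTop (𝓝 0) := by
      have h := ENNReal.Tendsto.const_mul h1 (Or.inr hK)
      rwa [mul_zero] at h
    have h3 := (ENNReal.tendsto_toReal ENNReal.zero_ne_top).comp h2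
    rwa [ENNReal.toReal_zero] at h3
  rw [Metric.tendsto_atTop]
  intro ε hε
  have hδ : (0 : ℝ) < ε / (4 * (cv + 1)) := by positivity
  obtain ⟨n₀, hn₀⟩ := eventually_atTop.1 (hA0.eventually (gt_mem_nhds hδ))
  set A : ℝ := (K * tail n₀ ^ θ).toReal with hA_def
  have hA0' : 0 ≤ A := ENNReal.toReal_nonneg
  have hAδ : A < ε / (4 * (cv + 1)) := hn₀ n₀ le_rfl
  set I₀ : ℝ≥0∞ := ∫⁻ x in closedBall (0 : EuclideanSpace ℝ (Fin 3)) n₀, F x with hI₀_def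
  have hI₀ : I₀ ≠ ⊤ := hFloc n₀
  refine ⟨max ((n₀ : ℝ) + 1) (4 * I₀.toReal / ε), fun R hR => ?_⟩
  have hRn₀ : (n₀ : ℝ) ≤ R := by linarith [le_max_left ((n₀ : ℝ) + 1) (4 * I₀.toReal / ε)]
  have hR0 : 0 < R := by
    have : (0 : ℝ) ≤ n₀ := Nat.cast_nonneg _
    linarith [le_max_left ((n₀ : ℝ) + 1) (4 * I₀.toReal / ε)]
  have hRI : 4 * I₀.toReal / ε ≤ R := (le_max_right _ _).trans hR
  -- split the integral at the radius `n₀`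
  set S : Set (EuclideanSpace ℝ (Fin 3)) := closedBall (0 : EuclideanSpace ℝ (Fin 3)) (2 * R) \ closedBall (0 : EuclideanSpace ℝ (Fin 3)) n₀
    with hS_def
  have hS : MeasurableSet S := measurableSet_closedBall.diff measurableSet_closedBall
  have hsplit : ∫⁻ x in closedBall (0 : EuclideanSpace ℝ (Fin 3)) (2 * R), F x ≤ I₀ + ∫⁻ x in S, F x := by
    calc ∫⁻ x in closedBall (0 : EuclideanSpace ℝ (Fin 3)) (2 * R), F x
        ≤ ∫⁻ x in S ∪ closedBall (0 : EuclideanSpace ℝ (Fin 3)) n₀, F x :=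
          lintegral_mono_set (subset_sdiff_union _ _)
      _ ≤ (∫⁻ x in S, F x) + I₀ := lintegral_union_le _ _ _
      _ = I₀ + ∫⁻ x in S, F x := add_comm _ _
  have hSG : ∫⁻ x in S, G x ≤ tail n₀ := lintegral_mono_set (sdiff_subset_compl _ _)
  have hvolS : volume S ^ (1 / 3 : ℝ) ≤ ENNReal.ofReal (2 * R) * v ^ (1 / 3 : ℝ) := by
    have h1 : volume S ≤ volume (closedBall (0 : EuclideanSpace ℝ (Fin 3)) (2 * R)) := measure_mono sdiff_subset
    have h2 : volume (closedBall (0 : EuclideanSpace ℝ (Fin 3)) (2 * R)) = ENNReal.ofReal ((2 * R) ^ 3) * v := by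
      rw [Measure.addHaar_closedBall _ _ (by positivity), finrank_euclideanSpace_fin]
    calc volume S ^ (1 / 3 : ℝ) ≤ (volume (closedBall (0 : EuclideanSpace ℝ (Fin 3)) (2 * R))) ^ (1 / 3 : ℝ) :=
          ENNReal.rpow_le_rpow h1 (by norm_num)
      _ = ENNReal.ofReal ((2 * R) ^ 3) ^ (1 / 3 : ℝ) * v ^ (1 / 3 : ℝ) := by
          rw [h2, ENNReal.mul_rpow_of_nonneg _ _ (by norm_num)]
      _ = ENNReal.ofReal (2 * R) * v ^ (1 / 3 : ℝ) := by
          congr 1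
          rw [ENNReal.ofReal_rpow_of_nonneg (by positivity) (by norm_num), ← Real.rpow_natCast,
            ← Real.rpow_mul (by positivity)]
          norm_num
  have hSF : ∫⁻ x in S, F x ≤ K * tail n₀ ^ θ * (ENNReal.ofReal (2 * R) * v ^ (1 / 3 : ℝ)) :=
    (hFG S hS).trans (mul_le_mul' (mul_le_mul' le_rfl (ENNReal.rpow_le_rpow hSG hθ.le)) hvolS)
  -- pass to real numbers
  have hKt : K * tail n₀ ^ θ ≠ ⊤ :=
    ENNReal.mul_ne_top hK (ENNReal.rpow_ne_top_of_nonneg hθ.le (htailtop n₀))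
  have hfinS : K * tail n₀ ^ θ * (ENNReal.ofReal (2 * R) * v ^ (1 / 3 : ℝ)) ≠ ⊤ :=
    ENNReal.mul_ne_top hKt (ENNReal.mul_ne_top ENNReal.ofReal_ne_top hv3top)
  have hreal : (∫⁻ x in closedBall (0 : EuclideanSpace ℝ (Fin 3)) (2 * R), F x).toReal ≤
      I₀.toReal + A * (2 * R * cv) := by
    have h := ENNReal.toReal_mono (ENNReal.add_ne_top.2 ⟨hI₀, hfinS⟩)
      (hsplit.trans (add_le_add le_rfl hSF))
    have e : (I₀ + K * tail n₀ ^ θ * (ENNReal.ofReal (2 * R) * v ^ (1 / 3 : ℝ))).toReal =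
        I₀.toReal + A * (2 * R * cv) := by
      rw [ENNReal.toReal_add hI₀ hfinS, ENNReal.toReal_mul (a := K * tail n₀ ^ θ),
        ENNReal.toReal_mul (a := ENNReal.ofReal (2 * R)), ENNReal.toReal_ofReal (by positivity),
        ← hA_def, ← hcv, mul_assoc]
    rwa [e] at h
  -- the two halves of `ε`
  have hfirst : I₀.toReal / R ≤ ε / 4 := by
    rw [div_le_iff₀ hR0]
    have h := (div_le_iff₀ hε).1 hRI
    linarith
  have hsecond : 2 * cv * A ≤ ε / 2 := by
    calc 2 * cv * A ≤ 2 * cv * (ε / (4 * (cv + 1))) := by gcongr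
      _ ≤ ε / 2 := by
          rw [mul_div_assoc', div_le_div_iff₀ (by positivity) (by positivity)]
          nlinarith
  have hnonneg : 0 ≤ R⁻¹ * (∫⁻ x in closedBall (0 : EuclideanSpace ℝ (Fin 3)) (2 * R), F x).toReal := by positivity
  rw [Real.dist_eq, sub_zero, abs_of_nonneg hnonneg]
  calc R⁻¹ * (∫⁻ x in closedBall (0 : EuclideanSpace ℝ (Fin 3)) (2 * R), F x).toReal
      ≤ R⁻¹ * (I₀.toReal + A * (2 * R * cv)) := by gcongr
    _ = I₀.toReal / R + 2 * cv * A := by field_simp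
    _ ≤ ε / 4 + ε / 2 := add_le_add hfirst hsecond
    _ < ε := by linarith

end Tails

/-! ## §3. Galdi's theorem -/

section Main

/-- A continuous field tending to `0` at infinity is bounded. [folklore] -/
theorem exists_forall_norm_le_of_tendsto_cocompact {U : EuclideanSpace ℝ (Fin 3) → EuclideanSpace ℝ (Fin 3)} (hUc : Continuous U)
    (hdecay : Tendsto U (cocompact (EuclideanSpace ℝ (Fin 3))) (𝓝 0)) : ∃ M : ℝ, ∀ x, ‖U x‖ ≤ M := by
  have h1 : ∀ᶠ x in cocompact (EuclideanSpace ℝ (Fin 3)), ‖U x‖ < 1 := by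
    have h := hdecay.eventually (Metric.ball_mem_nhds (0 : EuclideanSpace ℝ (Fin 3)) one_pos)
    filter_upwards [h] with x hx
    simpa using hx
  obtain ⟨K, hK, hKU⟩ := mem_cocompact.1 h1
  obtain ⟨M, hM⟩ := hK.exists_bound_of_continuousOn hUc.continuousOn
  refine ⟨max M 1, fun x => ?_⟩
  by_cases hx : x ∈ K
  · exact (hM x hx).trans (le_max_left _ _)
  · exact (le_of_lt (hKU hx)).trans (le_max_right _ _)

/-- **Galdi's `L^{9/2}` Liouville criterion, discharged** (Galdi 2011, Theorem X.9.5, p. 729;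
restated in Seregin–Wang 2020, §1 / Remark 1.2 (i) and Wang 2025, Thm 2.2): a `C²` steady solution
`(U, P)` of `−νΔU + (U·∇)U + ∇P = 0`, `div U = 0` on `ℝ³` (`ν > 0`) with finite Dirichlet
integral, `U → 0` at infinity and `U ∈ L^{9/2}(ℝ³)` vanishes identically. Proof as in print
(Galdi, proof of Thm X.9.5; Wang 2025, (2.11)): (i) `U ∈ C^∞`
(`IsLerayProfile.contDiff_velocity_infty`); (ii) the Calderón–Zygmund pressure `Q ∈ L^{9/4}`,
`−ΔQ = ∂ᵢ∂ⱼ(UᵢUⱼ)` (`nrs1996_rieszPressure_holds`), and `P − Q = c` a.e.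
(`IsLerayProfile.exists_sub_ae_eq_const_nineHalves`); (iii) the localized energy (Caccioppoli)
inequality `ν∫_{B_R}|∇U|² ≤ νC₂/(2R²)∫_{B̄_{2R}}|U|² + C₁/(2R)∫_{B̄_{2R}}|U|³ + C₁/R∫_{B̄_{2R}}|P−c||U|`
(`IsLerayProfile.exists_gradient_estimate_consts` at `a = 0`); (iv) by Hölder with `U ∈ L^{9/2}`,
`Q ∈ L^{9/4}`, the right-hand side is `O(R^{-1/3}) + o(1)` as `R → ∞`; hence `∇U ≡ 0`, `U` is
constant, and `U → 0` forces `U ≡ 0`. (The finite-Dirichlet-integral hypothesis is not needed by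
this argument.) [cite: Galdi2011, Thm X.9.5] -/
theorem galdi_liouville_nineHalves_holds : galdi_liouville_nineHalves := by
  intro ν hν U P hprof _hD hdecay hU92
  -- regularity and measurability
  have hUinf : ContDiff ℝ ∞ U := hprof.contDiff_velocity_infty hν.ne' (by simp)
  have hU2 : ContDiff ℝ 2 U := hprof.contDiff_velocity
  have hU1 : ContDiff ℝ 1 U := hU2.of_le one_le_two
  have hUc : Continuous U := hU1.continuous
  have hP1 : ContDiff ℝ 1 P := hprof.contDiff_pressure
  have hUm : AEStronglyMeasurable U volume := hUc.aestronglyMeasurable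
  -- boundedness of `U`
  obtain ⟨M, hM⟩ := exists_forall_norm_le_of_tendsto_cocompact hUc hdecay
  have hM0 : 0 ≤ M := (norm_nonneg _).trans (hM 0)
  -- `∫ |U|^{9/2} < ∞`
  have hIU : ∫⁻ y, ‖U y‖ₑ ^ (9 / 2 : ℝ) < ⊤ := by
    have h := hU92.2
    have h0 : (9 / 2 : ℝ≥0∞) ≠ 0 := by norm_num
    have htop : (9 / 2 : ℝ≥0∞) ≠ ⊤ := by
      rw [Ne, ENNReal.div_eq_top]
      norm_num
    rw [eLpNorm_lt_top_iff_lintegral_rpow_enorm_lt_top h0 htop] at h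
    have e : (9 / 2 : ℝ≥0∞).toReal = 9 / 2 := by
      rw [ENNReal.toReal_div, ENNReal.toReal_ofNat, ENNReal.toReal_ofNat]
    rwa [e] at h
  -- the Calderón–Zygmund pressure `Q ∈ L^{9/4}`
  obtain ⟨C, hC⟩ := nrs1996_rieszPressure_holds (9 / 4) (by norm_num)
  have h2q : (2 : ℝ) * (9 / 4) = 9 / 2 := by norm_num
  have hIU' : ∫⁻ y, ‖U y‖ₑ ^ (2 * (9 / 4 : ℝ)) < ⊤ := by rwa [h2q]
  obtain ⟨Q, hQm, hQbound, hQeq⟩ := hC hUm hIU'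
  rw [h2q] at hQbound
  have hIQ : ∫⁻ y, ‖Q y‖ₑ ^ (9 / 4 : ℝ) ≠ ⊤ :=
    (hQbound.trans_lt (ENNReal.mul_lt_top ENNReal.coe_lt_top hIU)).ne
  have hpq₃ : (9 / 4 : ℝ).HolderConjugate (9 / 5) := ⟨by norm_num, by norm_num, by norm_num⟩
  have hQl : LocallyIntegrable Q volume := locallyIntegrable_of_holder hQm hpq₃ hIQ
  -- `P - Q = c` a.e.
  obtain ⟨c, hc⟩ := hprof.exists_sub_ae_eq_const_nineHalves hM hIU.ne hQm hIQ hQeq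
  -- the Caccioppoli inequality on balls centred at the origin
  obtain ⟨C₁, C₂, hC₁0, hC₂0, hest⟩ := IsLerayProfile.exists_gradient_estimate_consts
  have key : ∀ R : ℝ, 0 < R → ν * ∫ x in ball (0 : EuclideanSpace ℝ (Fin 3)) R, frobeniusNormSq (fderiv ℝ U x) ≤
      ν * C₂ / (2 * R ^ 2) * (∫ x in closedBall (0 : EuclideanSpace ℝ (Fin 3)) (2 * R), ‖U x‖ ^ 2)
        + C₁ / (2 * R) * (∫ x in closedBall (0 : EuclideanSpace ℝ (Fin 3)) (2 * R), ‖U x‖ ^ 3)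
        + C₁ / R * ∫ x in closedBall (0 : EuclideanSpace ℝ (Fin 3)) (2 * R), |P x - c| * ‖U x‖ := by
    intro R hR
    have h := hest hprof hUinf hν.le le_rfl hR 0 c
    simpa only [zero_div, zero_mul, add_zero] using h
  -- (1) the quadratic term is `O(R^{-1/3})`
  have T1 : Tendsto (fun R : ℝ => ν * C₂ / (2 * R ^ 2) *
      ∫ x in closedBall (0 : EuclideanSpace ℝ (Fin 3)) (2 * R), ‖U x‖ ^ 2) atTop (𝓝 0) := by
    have hpq : (9 / 4 : ℝ).HolderConjugate (9 / 5) := hpq₃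
    have hU2m : AEStronglyMeasurable (fun x => ‖U x‖ ^ 2) volume :=
      (hUc.norm.pow 2).aestronglyMeasurable
    have hIU2 : ∫⁻ x, ‖(‖U x‖ ^ 2)‖ₑ ^ (9 / 4 : ℝ) ≠ ⊤ := by
      have h : ∀ x, ‖(‖U x‖ ^ 2)‖ₑ ^ (9 / 4 : ℝ) = ‖U x‖ₑ ^ (9 / 2 : ℝ) := fun x => by
        rw [Real.enorm_eq_ofReal (sq_nonneg _), ENNReal.ofReal_pow (norm_nonneg _), ofReal_norm,
          ← ENNReal.rpow_natCast, ← ENNReal.rpow_mul]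
        norm_num
      simp_rw [h]
      exact hIU.ne
    set A : ℝ := ((∫⁻ x, ‖(‖U x‖ ^ 2)‖ₑ ^ (9 / 4 : ℝ)) ^ (1 / (9 / 4 : ℝ)) *
      volume (ball (0 : EuclideanSpace ℝ (Fin 3)) 1) ^ (1 / (9 / 5 : ℝ))).toReal with hA
    have hA0 : 0 ≤ A := ENNReal.toReal_nonneg
    have hJ2 : ∀ R : ℝ, 0 < R →
        ∫ x in closedBall (0 : EuclideanSpace ℝ (Fin 3)) (2 * R), ‖U x‖ ^ 2 ≤
          A * (2 * R) ^ (5 / 3 : ℝ) := by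
      intro R hR
      have h := (setIntegral_norm_closedBall_le_holder hU2m hpq hIU2
        (by positivity : (0 : ℝ) < 2 * R)).2
      have e : ∀ x, ‖(‖U x‖ ^ 2)‖ = ‖U x‖ ^ 2 := fun x => Real.norm_of_nonneg (sq_nonneg _)
      simp_rw [e] at h
      refine h.trans_eq ?_
      rw [hA]
      norm_num
    have hbound : ∀ᶠ R in atTop, ν * C₂ / (2 * R ^ 2) *
        ∫ x in closedBall (0 : EuclideanSpace ℝ (Fin 3)) (2 * R), ‖U x‖ ^ 2 ≤
          (ν * C₂ / 2 * A * 2 ^ (5 / 3 : ℝ)) * R ^ (-(1 / 3) : ℝ) := by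
      filter_upwards [eventually_gt_atTop 0] with R hR
      have e1 : (2 * R) ^ (5 / 3 : ℝ) = 2 ^ (5 / 3 : ℝ) * R ^ (5 / 3 : ℝ) :=
        Real.mul_rpow (by norm_num) hR.le
      have e2 : R ^ (-(1 / 3) : ℝ) = R ^ (5 / 3 : ℝ) / R ^ 2 := by
        rw [show (-(1 / 3) : ℝ) = 5 / 3 - 2 by norm_num, Real.rpow_sub hR, Real.rpow_two]
      calc ν * C₂ / (2 * R ^ 2) * ∫ x in closedBall (0 : EuclideanSpace ℝ (Fin 3)) (2 * R), ‖U x‖ ^ 2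
          ≤ ν * C₂ / (2 * R ^ 2) * (A * (2 * R) ^ (5 / 3 : ℝ)) := by
            gcongr
            exact hJ2 R hR
        _ = (ν * C₂ / 2 * A * 2 ^ (5 / 3 : ℝ)) * R ^ (-(1 / 3) : ℝ) := by
            rw [e1, e2]
            field_simp
    have hnonneg : ∀ᶠ R in atTop, 0 ≤ ν * C₂ / (2 * R ^ 2) *
        ∫ x in closedBall (0 : EuclideanSpace ℝ (Fin 3)) (2 * R), ‖U x‖ ^ 2 := by
      filter_upwards [eventually_gt_atTop 0] with R hR
      exact mul_nonneg (by positivity) (integral_nonneg fun x => by positivity)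
    have hlim : Tendsto (fun R : ℝ => (ν * C₂ / 2 * A * 2 ^ (5 / 3 : ℝ)) * R ^ (-(1 / 3) : ℝ))
        atTop (𝓝 0) := by
      simpa using (tendsto_rpow_neg_atTop (by norm_num : (0 : ℝ) < 1 / 3)).const_mul
        (ν * C₂ / 2 * A * 2 ^ (5 / 3 : ℝ))
    exact squeeze_zero' hnonneg hbound hlim
  -- (2) the cubic term is `o(1)`
  have T2 : Tendsto (fun R : ℝ => C₁ / (2 * R) *
      ∫ x in closedBall (0 : EuclideanSpace ℝ (Fin 3)) (2 * R), ‖U x‖ ^ 3) atTop (𝓝 0) := by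
    have hFloc : ∀ r : ℝ, ∫⁻ x in closedBall (0 : EuclideanSpace ℝ (Fin 3)) r, ‖U x‖ₑ ^ (3 : ℝ) ≠ ⊤ := by
      intro r
      have hpt : ∀ x, ‖U x‖ₑ ^ (3 : ℝ) ≤ ENNReal.ofReal M ^ (3 : ℝ) := fun x => by
        refine ENNReal.rpow_le_rpow ?_ (by norm_num)
        rw [← ofReal_norm]
        exact ENNReal.ofReal_le_ofReal (hM x)
      refine ne_top_of_le_ne_top ?_ (lintegral_mono fun x => hpt x)
      rw [lintegral_const, Measure.restrict_apply_univ]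
      exact ENNReal.mul_ne_top (ENNReal.rpow_ne_top_of_nonneg (by norm_num) ENNReal.ofReal_ne_top)
        measure_closedBall_lt_top.ne
    have T2' := tendsto_inv_mul_setLIntegral_closedBall (F := fun x => ‖U x‖ₑ ^ (3 : ℝ))
      (G := fun x => ‖U x‖ₑ ^ (9 / 2 : ℝ)) hFloc (hUm.aemeasurable.enorm.pow_const _) hIU.ne
      ENNReal.one_ne_top (by norm_num : (0 : ℝ) < 2 / 3)
      (fun S _ => by simpa only [one_mul] using setLIntegral_rpow_three_le hUm S)
    have hconv : ∀ R : ℝ, ∫ x in closedBall (0 : EuclideanSpace ℝ (Fin 3)) (2 * R), ‖U x‖ ^ 3 =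
        (∫⁻ x in closedBall (0 : EuclideanSpace ℝ (Fin 3)) (2 * R), ‖U x‖ₑ ^ (3 : ℝ)).toReal := by
      intro R
      have hm3 : AEStronglyMeasurable (fun x => ‖U x‖ ^ 3) volume :=
        (hUc.norm.pow 3).aestronglyMeasurable
      rw [integral_eq_lintegral_of_nonneg_ae (ae_of_all _ fun x => by positivity) hm3.restrict]
      congr 1
      refine lintegral_congr fun x => ?_
      rw [show (3 : ℝ) = ((3 : ℕ) : ℝ) by norm_num, ENNReal.rpow_natCast, ← ofReal_norm,
        ENNReal.ofReal_pow (norm_nonneg _)]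
    have h := T2'.const_mul (C₁ / 2)
    rw [mul_zero] at h
    refine h.congr' (Eventually.of_forall fun R => ?_)
    show C₁ / 2 * (R⁻¹ * (∫⁻ x in closedBall (0 : EuclideanSpace ℝ (Fin 3)) (2 * R), ‖U x‖ₑ ^ (3 : ℝ)).toReal) =
      C₁ / (2 * R) * ∫ x in closedBall (0 : EuclideanSpace ℝ (Fin 3)) (2 * R), ‖U x‖ ^ 3
    rw [hconv R]
    ring
  -- (3) the pressure term is `o(1)`
  have T3 : Tendsto (fun R : ℝ => C₁ / R *
      ∫ x in closedBall (0 : EuclideanSpace ℝ (Fin 3)) (2 * R), |P x - c| * ‖U x‖) atTop (𝓝 0) := by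
    set KQ : ℝ≥0∞ := (∫⁻ x, ‖Q x‖ₑ ^ (9 / 4 : ℝ)) ^ (4 / 9 : ℝ) with hKQ
    have hKQtop : KQ ≠ ⊤ := ENNReal.rpow_ne_top_of_nonneg (by norm_num) hIQ
    have hFloc : ∀ r : ℝ, ∫⁻ x in closedBall (0 : EuclideanSpace ℝ (Fin 3)) r, ‖Q x‖ₑ * ‖U x‖ₑ ≠ ⊤ := by
      intro r
      have hpt : ∀ x, ‖Q x‖ₑ * ‖U x‖ₑ ≤ ‖Q x‖ₑ * ENNReal.ofReal M := fun x => by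
        refine mul_le_mul' le_rfl ?_
        rw [← ofReal_norm]
        exact ENNReal.ofReal_le_ofReal (hM x)
      refine ne_top_of_le_ne_top ?_ (lintegral_mono fun x => hpt x)
      rw [lintegral_mul_const' _ _ ENNReal.ofReal_ne_top]
      exact ENNReal.mul_ne_top (hQl.integrableOn_isCompact (isCompact_closedBall 0 r)).2.ne
        ENNReal.ofReal_ne_top
    have hFG : ∀ S : Set (EuclideanSpace ℝ (Fin 3)), MeasurableSet S → ∫⁻ x in S, ‖Q x‖ₑ * ‖U x‖ₑ ≤
        KQ * (∫⁻ x in S, ‖U x‖ₑ ^ (9 / 2 : ℝ)) ^ (2 / 9 : ℝ) * volume S ^ (1 / 3 : ℝ) := by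
      intro S _
      have h := setLIntegral_enorm_mul_enorm_le hQm hUm S
      have hK : (∫⁻ x in S, ‖Q x‖ₑ ^ (9 / 4 : ℝ)) ^ (4 / 9 : ℝ) ≤ KQ :=
        ENNReal.rpow_le_rpow (setLIntegral_le_lintegral _ _) (by norm_num)
      calc ∫⁻ x in S, ‖Q x‖ₑ * ‖U x‖ₑ
          ≤ (∫⁻ x in S, ‖Q x‖ₑ ^ (9 / 4 : ℝ)) ^ (4 / 9 : ℝ) *
              ((∫⁻ x in S, ‖U x‖ₑ ^ (9 / 2 : ℝ)) ^ (2 / 9 : ℝ) * volume S ^ (1 / 3 : ℝ)) := h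
        _ ≤ KQ * ((∫⁻ x in S, ‖U x‖ₑ ^ (9 / 2 : ℝ)) ^ (2 / 9 : ℝ) * volume S ^ (1 / 3 : ℝ)) :=
            mul_le_mul' hK le_rfl
        _ = KQ * (∫⁻ x in S, ‖U x‖ₑ ^ (9 / 2 : ℝ)) ^ (2 / 9 : ℝ) * volume S ^ (1 / 3 : ℝ) :=
            (mul_assoc _ _ _).symm
    have T3' := tendsto_inv_mul_setLIntegral_closedBall (F := fun x => ‖Q x‖ₑ * ‖U x‖ₑ)
      (G := fun x => ‖U x‖ₑ ^ (9 / 2 : ℝ)) hFloc (hUm.aemeasurable.enorm.pow_const _) hIU.ne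
      hKQtop (by norm_num : (0 : ℝ) < 2 / 9) hFG
    have hconv : ∀ R : ℝ, ∫ x in closedBall (0 : EuclideanSpace ℝ (Fin 3)) (2 * R), |P x - c| * ‖U x‖ =
        (∫⁻ x in closedBall (0 : EuclideanSpace ℝ (Fin 3)) (2 * R), ‖Q x‖ₑ * ‖U x‖ₑ).toReal := by
      intro R
      have hae : ∀ᵐ x ∂(volume.restrict (closedBall (0 : EuclideanSpace ℝ (Fin 3)) (2 * R))),
          |P x - c| * ‖U x‖ = |Q x| * ‖U x‖ := by
        filter_upwards [ae_restrict_of_ae hc] with x hx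
        rw [show P x - c = Q x by linarith]
      have hm : AEStronglyMeasurable (fun x => |Q x| * ‖U x‖) volume :=
        (continuous_abs.comp_aestronglyMeasurable hQm).mul hUc.norm.aestronglyMeasurable
      rw [integral_congr_ae hae, integral_eq_lintegral_of_nonneg_ae
        (ae_of_all _ fun x => by positivity) hm.restrict]
      congr 1
      refine lintegral_congr fun x => ?_
      rw [ENNReal.ofReal_mul (abs_nonneg _), ← Real.enorm_eq_ofReal_abs, ofReal_norm]
    have h := T3'.const_mul C₁
    rw [mul_zero] at h
    refine h.congr' (Eventually.of_forall fun R => ?_)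
    show C₁ * (R⁻¹ * (∫⁻ x in closedBall (0 : EuclideanSpace ℝ (Fin 3)) (2 * R), ‖Q x‖ₑ * ‖U x‖ₑ).toReal) =
      C₁ / R * ∫ x in closedBall (0 : EuclideanSpace ℝ (Fin 3)) (2 * R), |P x - c| * ‖U x‖
    rw [hconv R]
    ring
  have hsum : Tendsto (fun R : ℝ => ν * C₂ / (2 * R ^ 2) *
      (∫ x in closedBall (0 : EuclideanSpace ℝ (Fin 3)) (2 * R), ‖U x‖ ^ 2)
        + C₁ / (2 * R) * (∫ x in closedBall (0 : EuclideanSpace ℝ (Fin 3)) (2 * R), ‖U x‖ ^ 3)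
        + C₁ / R * ∫ x in closedBall (0 : EuclideanSpace ℝ (Fin 3)) (2 * R), |P x - c| * ‖U x‖)
      atTop (𝓝 0) := by
    have h := (T1.add T2).add T3
    rwa [add_zero, add_zero] at h
  -- the Dirichlet integral vanishes on every ball
  set f : EuclideanSpace ℝ (Fin 3) → ℝ := fun x => frobeniusNormSq (fderiv ℝ U x) with hf_def
  have hfc : Continuous f := continuous_frobeniusNormSq_fderiv hU2 two_ne_zero
  have hf0 : ∀ x, 0 ≤ f x := fun x => frobeniusNormSq_nonneg _
  have hfi : ∀ r : ℝ, IntegrableOn f (ball (0 : EuclideanSpace ℝ (Fin 3)) r) volume := fun r =>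
    (hfc.continuousOn.integrableOn_compact (isCompact_closedBall 0 r)).mono_set
      ball_subset_closedBall
  have hball0 : ∀ ρ : ℝ, 0 < ρ → ∫ x in ball (0 : EuclideanSpace ℝ (Fin 3)) ρ, f x = 0 := by
    intro ρ hρ
    have hle : ∀ᶠ R in atTop, ν * ∫ x in ball (0 : EuclideanSpace ℝ (Fin 3)) ρ, f x ≤
        ν * C₂ / (2 * R ^ 2) * (∫ x in closedBall (0 : EuclideanSpace ℝ (Fin 3)) (2 * R), ‖U x‖ ^ 2)
          + C₁ / (2 * R) * (∫ x in closedBall (0 : EuclideanSpace ℝ (Fin 3)) (2 * R), ‖U x‖ ^ 3)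
          + C₁ / R * ∫ x in closedBall (0 : EuclideanSpace ℝ (Fin 3)) (2 * R), |P x - c| * ‖U x‖ := by
      filter_upwards [eventually_ge_atTop ρ] with R hρR
      have hR : 0 < R := hρ.trans_le hρR
      refine le_trans ?_ (key R hR)
      refine mul_le_mul_of_nonneg_left ?_ hν.le
      exact setIntegral_mono_set (hfi R) (ae_of_all _ hf0)
        (LE.le.eventuallyLE (show ball (0 : EuclideanSpace ℝ (Fin 3)) ρ ≤ ball 0 R from ball_subset_ball hρR))
    have h0 : ν * ∫ x in ball (0 : EuclideanSpace ℝ (Fin 3)) ρ, f x ≤ 0 := ge_of_tendsto hsum hle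
    have hI0 : 0 ≤ ∫ x in ball (0 : EuclideanSpace ℝ (Fin 3)) ρ, f x := integral_nonneg hf0
    by_contra hne
    have hpos : 0 < ∫ x in ball (0 : EuclideanSpace ℝ (Fin 3)) ρ, f x := lt_of_le_of_ne hI0 (Ne.symm hne)
    exact absurd h0 (not_le.2 (mul_pos hν hpos))
  -- hence `|DU|² ≡ 0`
  have hfzero : f = fun _ => 0 := by
    have hae : ∀ n : ℕ, ∀ᵐ x ∂(volume.restrict (ball (0 : EuclideanSpace ℝ (Fin 3)) (n + 1))), f x = 0 := fun n =>
      (setIntegral_eq_zero_iff_of_nonneg_ae (ae_of_all _ hf0) (hfi _)).1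
        (hball0 (n + 1) (by positivity))
    have hae' : ∀ᵐ x ∂(volume : Measure (EuclideanSpace ℝ (Fin 3))), f x = (fun _ => (0 : ℝ)) x := by
      have h := (ae_restrict_iUnion_iff (fun n : ℕ => ball (0 : EuclideanSpace ℝ (Fin 3)) (n + 1))
        (fun x => f x = 0)).2 hae
      rwa [iUnion_ball_nat_succ, Measure.restrict_univ] at h
    exact Measure.eq_of_ae_eq hae' hfc continuous_const
  -- `DU ≡ 0`, `U` is constant, and `U → 0` at infinity forces `U ≡ 0`
  have hDU : ∀ x, fderiv ℝ U x = 0 := fun x => by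
    have h1 : frobeniusNormSq (fderiv ℝ U x) = 0 := congrFun hfzero x
    have h2 := sq_opNorm_le_frobeniusNormSq (fderiv ℝ U x)
    rw [h1] at h2
    have h3 : ‖fderiv ℝ U x‖ = 0 := by nlinarith [norm_nonneg (fderiv ℝ U x)]
    exact norm_eq_zero.1 h3
  have hconst : ∀ x, U x = U 0 := fun x =>
    is_const_of_fderiv_eq_zero (hU1.differentiable one_ne_zero) hDU x 0
  have hU0 : U 0 = 0 := by
    have h1 : Tendsto U (cocompact (EuclideanSpace ℝ (Fin 3))) (𝓝 (U 0)) := by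
      rw [show U = fun _ => U 0 from funext hconst]
      exact tendsto_const_nhds
    exact tendsto_nhds_unique h1 hdecay
  funext x
  rw [hconst x, hU0]
  rfl

end Main

end Literature.Analysis.FluidPDE

end
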